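import Summits.CriticalPhenomena.PercolationContinuityZ3.Theorems.PercNearOneGluingNoHeavyLowerTailMajorityGluingQCertSym3Perm
import HarnessLib

/-!
# «At least `h` of `k` relays cut» from ANY passing symmetrised DEGREE-3 certificate (lane prim-rate, constants-miner 1, gen 36; NEXT-g37 item 1)

Support file for the closed crux `NoHeavyLowerTail` (stmt-CriticalPhenomena-4575), majority-gluing line.  The counting theorem of the CUBIC orbit-key
certificate machine `…MajorityGluingQCertSym3` (copy of `…QCertSymCount` one degree up): the family of points is the family of cut laws `lawFam w a₀ t δ g = lawvK w a₀ (t ∘ g) δ` of ALL `k!`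
relabellings of an enumeration `t` of the `k`-set `T` — each satisfies the marginal hypotheses and every well-formed van den Berg–Kahn row
(`row_lawvK`), all share `v_g(D) = δ` and `T(v_g) = μ(h ≤ #cut T)`, and the cubic key valuation `valS3` has the orbit property (`valS3_keyS3`) — so the abstract
soundness `SymCert3.sound3S` applies (`cut_of_posS3` / `cut_of_posS3_count` in evaluation form, for certificates checked in parts): **`cut_of_checkS3_count`**: if `c.check3S fuel = true` and `c.base.m = k`, then for every finite weighted graph, hub `a₀`,
`k`-set `T` and `δ ≥ 0` bounding the cut probabilities on `T`, `cD·μ(c.base.h ≤ #{v ∈ T : v ↮ a₀}) ≤ cN·δ`.  A symmetrised degree-3 certificate for any cell thus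
lands as data + one `decide +kernel` + an instantiation of this theorem (the end-to-end smoke statement coincides with `oneOfTwo_symSmoke` of the degree-2 file and is not repeated).  No sorries. [cite: VandenbergKahn2001, Thm 1.2 (p. 123)]
-/

noncomputable section

namespace Summit.CriticalPhenomena.PercolationContinuityZ3.Theorems

open MeasureTheory Set
open Literature.Probability.LatticeModels (prodBernoulli)
open Literature.Probability.Percolation
open scoped Classical

namespace HubOnly
namespace QCert

variable {n k : ℕ}

namespace SymCert3

variable (c : SymCert3) (hm : c.base.m = k)
include hm

/-- **«At least `h` of `k` cut» along an enumeration, evaluation form (degree 3):** a structurally sound symmetrised cubic certificate whose contribution list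
evaluates nonnegatively at every nonnegative key valuation gives `cD·μ(c.base.h ≤ #cut T) ≤ cN·δ`. [cite: VandenbergKahn2001, Thm 1.2 (p. 123)] -/
theorem cut_of_posS3 (hWS : c.checkW3S = true) (hpos : ∀ val : ℕ → ℝ, (∀ key, 0 ≤ val key) → 0 ≤ evalC val c.contribs3S)
    (w : Sym2 (Fin n) → unitInterval) (a₀ : Fin n) (t : Fin k → Fin n)
    (ht : Function.Injective t) (T : Finset (Fin n)) (hT : T = Finset.univ.image t)
    (δ : ℝ) (hδ0 : 0 ≤ δ) (hδ : ∀ x : Fin k, (prodBernoulli w).real (openConn a₀ (t x) : Set (BondConfig (Fin n)))ᶜ ≤ δ) :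
    (c.base.cD : ℝ) * (prodBernoulli w).real
        {ω : BondConfig (Fin n) | c.base.h ≤ (T.filter fun x => ω ∉ (openConn a₀ x : Set (BondConfig (Fin n)))).card} ≤ c.base.cN * δ := by
  have hNV : c.NV = 2 ^ k + 1 := by rw [SymCert3.NV, Cert.NV, hm]
  have hD : c.base.D = 2 ^ k := by rw [Cert.D, hm]
  obtain ⟨_, _, _, _, _, hrowsOK, _⟩ := c.checkW3S_spec hWS
  set v := lawFam w a₀ t δ with hv_def
  have hv : ∀ g i, 0 ≤ v g i := fun g i => lawvK_nonneg w a₀ (t ∘ g) δ hδ0 i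
  have htg : ∀ g : Equiv.Perm (Fin k), Function.Injective (t ∘ ⇑g) := fun g => ht.comp g.injective
  have hTg : ∀ g : Equiv.Perm (Fin k), T = Finset.univ.image (t ∘ ⇑g) := fun g => by
    rw [← Finset.image_image, Finset.image_univ_of_surjective g.surjective, hT]
  exact c.sound3S_of_nonneg hWS v hv (valS3 v (2 ^ k + 1)) (hpos _ (valS3_nonneg v hv _))
    (by
      intro i hi j hj l hl
      rw [hNV] at hi hj hl
      rw [SymCert3.key, hm]
      exact valS3_keyS3 w a₀ t δ i j l hi hj hl)
    δ _ (fun g => by rw [hD]; exact lawvK_D w a₀ (t ∘ g) δ)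
    (fun g => by
      show linv c.NV (fun i => Cert.bi (c.base.tMem i)) (lawvK w a₀ (t ∘ ⇑g) δ) = _
      rw [hNV, linv_lawvK _ _ _ _ _ (tMemK_D c.base hm), setOf_tMemK c.base hm a₀ (t ∘ ⇑g) (htg g) T (hTg g)])
    (by
      intro g x hx
      rw [hm] at hx
      show linv c.NV (fun i => Cert.bi (c.base.margMem x i)) (lawvK w a₀ (t ∘ ⇑g) δ) ≤ lawvK w a₀ (t ∘ ⇑g) δ c.base.D
      rw [hNV, hD, lawvK_D, linv_lawvK _ _ _ _ _ (margMemK_D c.base hm x), setOf_margMemK c.base hm a₀ (t ∘ ⇑g) ⟨x, hx⟩]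
      exact hδ (g ⟨x, hx⟩))
    (by
      intro g ch hch r hr
      show linv c.NV _ (lawvK w a₀ (t ∘ ⇑g) δ) * linv c.NV _ (lawvK w a₀ (t ∘ ⇑g) δ) ≤
        linv c.NV _ (lawvK w a₀ (t ∘ ⇑g) δ) * linv c.NV _ (lawvK w a₀ (t ∘ ⇑g) δ)
      rw [hNV]
      exact row_lawvK c.base hm w a₀ (t ∘ ⇑g) (htg g) δ r.row (hrowsOK ch hch r hr).1)

/-- **«At least `h` of `k` cut» along an enumeration, for ANY passing symmetrised degree-3 certificate:** `cD·μ(c.base.h ≤ #cut T) ≤ cN·δ`.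
[cite: VandenbergKahn2001, Thm 1.2 (p. 123)] -/
theorem cut_of_checkS3 (fuel : ℕ) (hc : c.check3S fuel = true) (w : Sym2 (Fin n) → unitInterval) (a₀ : Fin n) (t : Fin k → Fin n)
    (ht : Function.Injective t) (T : Finset (Fin n)) (hT : T = Finset.univ.image t)
    (δ : ℝ) (hδ0 : 0 ≤ δ) (hδ : ∀ x : Fin k, (prodBernoulli w).real (openConn a₀ (t x) : Set (BondConfig (Fin n)))ᶜ ≤ δ) :
    (c.base.cD : ℝ) * (prodBernoulli w).real
        {ω : BondConfig (Fin n) | c.base.h ≤ (T.filter fun x => ω ∉ (openConn a₀ x : Set (BondConfig (Fin n)))).card} ≤ c.base.cN * δ := by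
  have hWQ : c.checkW3S = true ∧ c.checkQ3S fuel = true := by
    unfold check3S at hc; simpa only [Bool.and_eq_true] using hc
  exact c.cut_of_posS3 hm hWQ.1 (fun val hval => evalC_nonneg_of_runsOK_msort2 _ hval fuel _ hWQ.2) w a₀ t ht T hT δ hδ0 hδ

/-- **Counting form of the evaluation version, degree 3** (orientation `v ↮ a₀`; `|T| = k`). [cite: VandenbergKahn2001, Thm 1.2 (p. 123)] -/
theorem cut_of_posS3_count (hWS : c.checkW3S = true) (hpos : ∀ val : ℕ → ℝ, (∀ key, 0 ≤ val key) → 0 ≤ evalC val c.contribs3S)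
    (w : Sym2 (Fin n) → unitInterval) (a₀ : Fin n) (T : Finset (Fin n))
    (hT : T.card = k) (δ : ℝ) (hδ0 : 0 ≤ δ) (hδ : ∀ v ∈ T, (prodBernoulli w).real (openConn v a₀ : Set (BondConfig (Fin n)))ᶜ ≤ δ) :
    (c.base.cD : ℝ) * (prodBernoulli w).real {ω : BondConfig (Fin n) | c.base.h ≤ (T.filter fun v => ω ∉ openConn v a₀).card} ≤
      c.base.cN * δ := by
  have hδ' : ∀ x ∈ T, (prodBernoulli w).real (openConn a₀ x : Set (BondConfig (Fin n)))ᶜ ≤ δ := by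
    intro x hx; rw [knThm2_openConn_comm]; exact hδ x hx
  have hset : {ω : BondConfig (Fin n) | c.base.h ≤ (T.filter fun v => ω ∉ openConn v a₀).card} =
      {ω : BondConfig (Fin n) | c.base.h ≤ (T.filter (fun x => ω ∉ (openConn a₀ x : Set (BondConfig (Fin n))))).card} := by
    ext ω
    simp only [mem_setOf_eq]
    rw [Finset.filter_congr (fun v _ => by rw [knThm2_openConn_comm v a₀])]
  rw [hset]
  obtain ⟨t, ht, hTt, _⟩ := exists_sorted_enumK T hT (fun _ => (0 : ℝ))
  exact c.cut_of_posS3 hm hWS hpos w a₀ t ht T hTt δ hδ0 fun x =>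
    hδ' (t x) (by rw [hTt]; exact Finset.mem_image_of_mem _ (Finset.mem_univ _))

/-- **«AT LEAST `h` OF `k` RELAYS CUT» FOR ANY PASSING SYMMETRISED DEGREE-3 CERTIFICATE, counting form** (orientation `v ↮ a₀`; `|T| = k`; `δ ≥ 0` bounds
the `k` cut probabilities): `cD·μ(c.base.h ≤ #{v ∈ T : v ↮ a₀}) ≤ cN·δ`. [cite: VandenbergKahn2001, Thm 1.2 (p. 123)] -/
theorem cut_of_checkS3_count (fuel : ℕ) (hc : c.check3S fuel = true) (w : Sym2 (Fin n) → unitInterval) (a₀ : Fin n) (T : Finset (Fin n))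
    (hT : T.card = k) (δ : ℝ) (hδ0 : 0 ≤ δ) (hδ : ∀ v ∈ T, (prodBernoulli w).real (openConn v a₀ : Set (BondConfig (Fin n)))ᶜ ≤ δ) :
    (c.base.cD : ℝ) * (prodBernoulli w).real {ω : BondConfig (Fin n) | c.base.h ≤ (T.filter fun v => ω ∉ openConn v a₀).card} ≤
      c.base.cN * δ := by
  have hWQ : c.checkW3S = true ∧ c.checkQ3S fuel = true := by
    unfold check3S at hc; simpa only [Bool.and_eq_true] using hc
  exact c.cut_of_posS3_count hm hWQ.1 (fun val hval => evalC_nonneg_of_runsOK_msort2 _ hval fuel _ hWQ.2) w a₀ T hT δ hδ0 hδ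

end SymCert3

end QCert
end HubOnly

end Summit.CriticalPhenomena.PercolationContinuityZ3.Theorems

end
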